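import Summits.QuantumFields.YangMills.Theorems.UnitScaleTiltProp8ChartHInvLetter
import Summits.QuantumFields.YangMills.Theorems.UnitScaleTiltProp8ChartHInvBridge
import HarnessLib

/-!
# Route `UnitScaleTilt`, crux K1 «MinimiserStabilityRegPr» (stmt-QuantumFields-19200), leaf V2′ — the P2→P3 BRIDGE (hH of `ChartRemainderAt`),
# part C2′: **THE (46) GRADIENT ROW OF `H X = H₀X̃′ + dφ` ON C^{1,1} TENTS, AND THE PACKAGED BRIDGE `exists_rightInverse₂` WITH BOTH ROWS**
# (WANTED №g26-1 (X3′), OWNER RULING g26 04:53:50Z)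

Cell `ym3-torus`, width seat `ym-ust-19200-w5` gen 3 (count-neutral helper; `--supports stmt-QuantumFields-19200 --as helper`; def-free, 0 sorry).

WHY.  F4's two-letter currency (`FlatSmallSolution158CubeSeq.existsUnique_smallSolution158_dom`'s `hG`∕`hWq`∕`hWd`∕`h𝔄'`, `FlatProp4Dressing.hWq_of_dressing`'s `hH`, the
(152) gradient size `h2` of `A′ = A + HC(A)` — ✓ `HalvingSize152OfChart.size152_bond`) needs, besides the sup row `w 1 b·‖HX b‖ ≤ B·t` of the chart-`H` (✓ part C2
`ChartHInv.letter`∕`exists_rightInverse`), the GRADIENT row `w 2 b·η⁻¹·‖HX⟨b₋+e_ν, dir b⟩ − HX b‖ ≤ B′·t` ([Balaban1985Variational] (46)₂ *«|∇HB| ≦ B₀(Lʲη)⁻²|B|»*).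
On the piecewise-linear tents of part B2 this row FAILS by `L^{j(b)}` (kinks; seat w5 g3 LOCATED ✗ (X3), owner-accepted); on the C^{1,1} tents of part B2′
(`exists_smoothTent`: slope `8/L^j`, second differences `≤ 64/L^{2j}`) it holds: the gauge part's mixed second difference is a sum over the pins of the (at most four)
sites involved of `Δ²τ_s·Λ_s(Y)`, each `≤ (64/L^{2j_s})·C·L^{j_s}·t₁/(L^{j_s}η)`, and the territory collar (`levOf_endpoints_le_succ`, levels of adjacent sites differ by
`≤ 1`) turns the weight `(L^{j(b)}η)²·η⁻¹` into `≤ L⁴` per term; the flat part `Y = H₀ᴹX̃′` inherits `H₀`'s gradient row (P2's ✓ `HSupLetterG` row 2) by the sign-data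
argument of `letter_Y`.

WHAT THIS FILE PROVES (the construction of parts C1∕C2 VERBATIM as section hypotheses; NEW hypotheses: the weight `w₂ b = (L^{lev(b₋)}η)²`, `H₀`'s gradient row `hgrad`,
the tents' slope `σ` (`hτlipσ`) and second-difference row (`hτd2`)):
* §1 **`letter_Y_grad`** (`w₂ b·η⁻¹·‖Y(b+e_ν) − Y(b)‖ ≤ B₀(1+2C)t`), `norm_dphi_le_of_slope`∕**`letter_of_slope`** (the sup row for slope-`σ` tents, constant
  `B₀(1+2C)(1 + σC(1+L))`, `C = (d+2)L`; `σ = 2` is part C2's `letter`), **`norm_d2phi_le`** (`w₂ b·η⁻¹·‖φ(x+e_ν+e_μ) − φ(x+e_ν) − φ(x+e_μ) + φ(x)‖ ≤ 256·C·L⁴·B₀(1+2C)t`),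
  **`letter_grad`** (the gradient row of `HX = Y + dφ`: `w₂ b·η⁻¹·‖HX⟨b₋+e_ν, dir b⟩ − HX b‖ ≤ B₀(1+2C)(1 + 256CL⁴)·t`);
* §2 ★★ **`exists_rightInverse₂`** — for a (2.2)-admissible family (`2L ≤ R·M + 1`), `H₀` a real right inverse of the straight averages with BOTH (46) rows (P2's
  `HSupLetterG`), `η > 0`: a ℂ-linear `H` on matrix data with `η·Q^{(j)}(HX) = X` on the index bonds (IDENTITY CLAUSE OF `exists_rightInverse` VERBATIM), the sup row
  `w₁ b·‖HX b‖ ≤ B₀(1+2C)(1+8C(1+L))·t` (shape of record, slope constant `2 → 8`) AND the gradient row `w₂ b·η⁻¹·‖HX⟨b₋+e_ν, dir b⟩ − HX b‖ ≤ B₀(1+2C)(1+256CL⁴)·t`.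
HONEST SCOPE: bookkeeping over parts A–C and B2′; the carrier reading (`η = L^{−(K−n)}`, `IsLevWeight`, P2's `flatH`) is the one-screen corollary of
`ChartHInvFromFlatOps.hH_of_flatH`'s pattern (next file).  NOT a claim about the mass gap.

References: T. Bałaban, CMP **102** (1985) 277–309 [Balaban1985Variational] ((45)–(46) p.285, (152) p.301, (156)–(157) p.302); CMP **98** (1985) 17–51
[Balaban1985Averaging] ((62) p.28); CMP **96** (1984) 223–250 [Balaban1984PropagatorsII] ((2.1)–(2.4) p.224, (2.20) p.226, (2.147) p.248).
-/

set_option autoImplicit false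

noncomputable section

open scoped BigOperators Matrix.Norms.L2Operator

namespace Summit.QuantumFields.YangMills.Theorems.ChartHInv

open Literature.MathematicalPhysics.QuantumFieldTheory.Balaban1983to89
open T4Continuum BlockAveraging BlockAveragingEMLLinearised LatticeFieldCalculus
open B5Eq118OneStroke (iterBlockOf iterBlockOf_zero iterBlockOf_succ)
open B15DeterminingSets (embIter)
open B6SectADomainsV1 (Domains)
open B6SectAOperatorsV1 (BondIdx SiteIdx)
open B11Eq115Space (levOf)
open Summit.QuantumFields.YangMills.Theorems.FlatCubeOpsText (Adm22)
open Summit.QuantumFields.YangMills.Theorems.Prop7CombGauge (combMean_add)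

variable {P : Params} {n : Type*}

section Construction

variable (D : Domains P) (η : ℝ)
  (Q : (i : ℕ) → (PBond P 0 → Matrix n n ℂ) → PBond P i → Matrix n n ℂ)
  (hQ0 : ∀ Y, Q 0 Y = Y) (hQs : ∀ (i : ℕ) (Y : PBond P 0 → Matrix n n ℂ) (c : PBond P (i + 1)), Q (i + 1) Y c = linAvg (Q i Y) c)
  (Λ : (i : ℕ) → (PBond P 0 → Matrix n n ℂ) → Site P i → Matrix n n ℂ)
  (hΛ0 : ∀ Y y, Λ 0 Y y = 0)
  (hΛs : ∀ (i : ℕ) (Y : PBond P 0 → Matrix n n ℂ) (y : Site P (i + 1)), Λ (i + 1) Y y = (P.L ^ i : ℕ) • combMean (bondAvgIter i Y) y + Λ i Y (emb y))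
  (Xf : (BondIdx D → Matrix n n ℂ) → (i : ℕ) → PBond P i → Matrix n n ℂ)
  (hXf : ∀ X i b, Xf X i b = if h : D.LamBond i b then X ⟨⟨⟨i, Nat.lt_succ_of_le (D.le_of_lamBond h)⟩, b⟩, h⟩ else 0)
  (κ : (BondIdx D → Matrix n n ℂ) → (j : ℕ) → Site P j → Matrix n n ℂ)
  (hκ0 : ∀ X y, κ X 0 y = 0)
  (hκs : ∀ X (i : ℕ) (y : Site P (i + 1)), κ X (i + 1) y = if y ∈ D.Om (i + 1) then 0 else combMean (Xf X i) y)
  (Xt : (BondIdx D → Matrix n n ℂ) → BondIdx D → Matrix n n ℂ)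
  (hXt : ∀ X idx, Xt X idx = (((P.L : ℝ) ^ (idx.1.1 : ℕ) * η)⁻¹) • (X idx + (κ X idx.1.1 idx.1.2.tgt - κ X idx.1.1 idx.1.2.src)))
  (H₀ : (BondIdx D → ℝ) →ₗ[ℝ] (PBond P 0 → ℝ)) (hinv : ∀ (X : BondIdx D → ℝ) (i : BondIdx D), bondAvgIter (i.1.1 : ℕ) (H₀ X) i.1.2 = X i)
  (Y : (BondIdx D → Matrix n n ℂ) → PBond P 0 → Matrix n n ℂ)
  (hY : ∀ X b, Y X b = ∑ i : BondIdx D, H₀ (Pi.single i 1) b • Xt X i)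
  (τ : SiteIdx D → Site P 0 → ℝ)
  (hτ1 : ∀ s, τ s (embIter (s.1.1 : ℕ) s.1.2) = 1) (hτ0 : ∀ s x, iterBlockOf (s.1.1 : ℕ) x ≠ s.1.2 → τ s x = 0)
  (φ : (BondIdx D → Matrix n n ℂ) → Site P 0 → Matrix n n ℂ)
  (hφ : ∀ X x, φ X x = ∑ s : SiteIdx D, τ s x • Λ (s.1.1 : ℕ) (Y X) s.1.2)

section Letter

variable [Fintype n] [DecidableEq n]
  (w₁ : PBond P 0 → ℝ) (hw₁ : ∀ b, w₁ b = (P.L : ℝ) ^ levOf (fun i => {z : Site P 0 | D.InOm i z}) D.k b.src * η)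
  (w₂ : PBond P 0 → ℝ) (hw₂ : ∀ b, w₂ b = ((P.L : ℝ) ^ levOf (fun i => {z : Site P 0 | D.InOm i z}) D.k b.src * η) ^ 2)
  {B₀ : ℝ}
  (hsup : ∀ (Xr : BondIdx D → ℝ) (t : ℝ), 0 ≤ t → (∀ i, ((P.L : ℝ) ^ (i.1.1 : ℕ) * η) * |Xr i| ≤ t) → ∀ b, w₁ b * |H₀ Xr b| ≤ B₀ * t)
  (hgrad : ∀ (Xr : BondIdx D → ℝ) (t : ℝ), 0 ≤ t → (∀ i, ((P.L : ℝ) ^ (i.1.1 : ℕ) * η) * |Xr i| ≤ t) →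
    ∀ (b : PBond P 0) (ν : Fin P.d), w₂ b * η⁻¹ * |H₀ Xr ⟨b.src.shift ν, b.dir⟩ - H₀ Xr b| ≤ B₀ * t)
  {σ : ℝ} (hσ : 0 ≤ σ)
  (hτlipσ : ∀ (s : SiteIdx D) (b : PBond P 0), |τ s b.tgt - τ s b.src| ≤ σ / (P.L : ℝ) ^ (s.1.1 : ℕ))
  (hτd2 : ∀ (s : SiteIdx D) (x : Site P 0) (μ ν : Fin P.d),
    |τ s ((x.shift ν).shift μ) - τ s (x.shift ν) - τ s (x.shift μ) + τ s x| ≤ 64 / ((P.L : ℝ) ^ (s.1.1 : ℕ)) ^ 2)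

include hXf hκ0 hκs hXt hY hgrad hw₂ in
/-- **THE GRADIENT ROW OF `Y = H₀ᴹX̃′`**: `w₂(b)·η⁻¹·‖Y(b+e_ν) − Y(b)‖ ≤ B₀(1 + 2(d+2)L)·t` — `H₀`'s gradient row tested on sign data of weighted size `(L^jη)⁻¹`
(the argument of `letter_Y`). [cite: Balaban1985Variational, (46) p.285] -/
theorem letter_Y_grad (hη : 0 < η) (X : BondIdx D → Matrix n n ℂ) {t : ℝ} (ht : 0 ≤ t) (hX : ∀ i, ‖X i‖ ≤ t) (b : PBond P 0) (ν : Fin P.d) :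
    w₂ b * η⁻¹ * ‖Y X ⟨b.src.shift ν, b.dir⟩ - Y X b‖ ≤ B₀ * ((1 + 2 * ((P.d + 2) * P.L : ℕ)) * t) := by
  classical
  set t₁ : ℝ := (1 + 2 * ((P.d + 2) * P.L : ℕ)) * t with ht₁
  have ht₁0 : 0 ≤ t₁ := by positivity
  set b' : PBond P 0 := ⟨b.src.shift ν, b.dir⟩ with hb'
  -- the sign data
  set K : BondIdx D → ℝ := fun i => H₀ (Pi.single i 1) b' - H₀ (Pi.single i 1) b with hK
  set Xr : BondIdx D → ℝ := fun i => if 0 ≤ K i then (((P.L : ℝ) ^ (i.1.1 : ℕ) * η)⁻¹) * t₁ else -((((P.L : ℝ) ^ (i.1.1 : ℕ) * η)⁻¹) * t₁)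
    with hXr
  have hwpos : ∀ i : BondIdx D, 0 < (P.L : ℝ) ^ (i.1.1 : ℕ) * η := fun i => by have := P.L_pos; positivity
  have hXr_abs : ∀ i, ((P.L : ℝ) ^ (i.1.1 : ℕ) * η) * |Xr i| ≤ t₁ := by
    intro i
    have habs : |Xr i| = (((P.L : ℝ) ^ (i.1.1 : ℕ) * η)⁻¹) * t₁ := by
      simp only [hXr]
      split_ifs
      · exact abs_of_nonneg (by positivity)
      · rw [abs_neg]; exact abs_of_nonneg (by positivity)
    rw [habs, ← mul_assoc, mul_inv_cancel₀ (hwpos i).ne', one_mul]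
  have hKX : ∀ i, K i * Xr i = |K i| * ((((P.L : ℝ) ^ (i.1.1 : ℕ) * η)⁻¹) * t₁) := by
    intro i
    simp only [hXr]
    split_ifs with h
    · rw [abs_of_nonneg h]
    · rw [abs_of_neg (not_le.mp h)]; ring
  -- `H₀ Xr b' − H₀ Xr b = Σ_i K_i Xr_i`
  have hdec : Xr = ∑ i, Xr i • (Pi.single i (1 : ℝ) : BondIdx D → ℝ) := by
    funext i'
    simp only [Finset.sum_apply, Pi.smul_apply, Pi.single_apply, smul_eq_mul, mul_ite, mul_one, mul_zero]
    rw [Finset.sum_ite_eq]; simp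
  have hH₀ : H₀ Xr b' - H₀ Xr b = ∑ i, K i * Xr i := by
    conv_lhs => rw [hdec]
    rw [map_sum, Finset.sum_apply, Finset.sum_apply, ← Finset.sum_sub_distrib]
    refine Finset.sum_congr rfl fun i _ => ?_
    rw [map_smul, Pi.smul_apply, Pi.smul_apply, smul_eq_mul, smul_eq_mul, ← mul_sub, mul_comm]
  -- the chain
  have hdiff : Y X b' - Y X b = ∑ i, K i • Xt X i := by
    rw [hY, hY, ← Finset.sum_sub_distrib]
    refine Finset.sum_congr rfl fun i _ => ?_
    rw [← sub_smul]
  have h1 : ‖Y X b' - Y X b‖ ≤ ∑ i, |K i| * ((((P.L : ℝ) ^ (i.1.1 : ℕ) * η)⁻¹) * t₁) := by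
    rw [hdiff]
    refine (norm_sum_le _ _).trans (Finset.sum_le_sum fun i _ => ?_)
    rw [norm_smul, Real.norm_eq_abs]
    exact mul_le_mul_of_nonneg_left (norm_Xt_le D η Xf hXf κ hκ0 hκs Xt hXt hη X ht hX i) (abs_nonneg _)
  have hw0 : 0 ≤ w₂ b * η⁻¹ := by rw [hw₂]; have := P.L_pos; positivity
  calc w₂ b * η⁻¹ * ‖Y X b' - Y X b‖ ≤ w₂ b * η⁻¹ * ∑ i, |K i| * ((((P.L : ℝ) ^ (i.1.1 : ℕ) * η)⁻¹) * t₁) := mul_le_mul_of_nonneg_left h1 hw0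
    _ = w₂ b * η⁻¹ * (H₀ Xr b' - H₀ Xr b) := by rw [hH₀]; simp_rw [hKX]
    _ ≤ w₂ b * η⁻¹ * |H₀ Xr b' - H₀ Xr b| := mul_le_mul_of_nonneg_left (le_abs_self _) hw0
    _ ≤ B₀ * t₁ := hgrad Xr t₁ ht₁0 hXr_abs b ν

include hΛ0 hΛs hXf hκ0 hκs hXt hY hτ0 hφ hw₁ hsup hτlipσ hσ in
/-- **THE SUP LETTER OF THE GAUGE PART FOR SLOPE-`σ` TENTS**: `‖φ(b₊) − φ(b₋)‖ ≤ σ·(d+2)L·B₀t₁·((L^{j₋}η)⁻¹ + (L^{j₊}η)⁻¹)` (part C2's `norm_dphi_le` is `σ = 2`).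
[cite: Balaban1985Variational, (46) p.285] -/
theorem norm_dphi_le_of_slope (hη : 0 < η) (hB₀ : 0 ≤ B₀) (X : BondIdx D → Matrix n n ℂ) {t : ℝ} (ht : 0 ≤ t) (hX : ∀ i, ‖X i‖ ≤ t) (b : PBond P 0) :
    ‖φ X b.tgt - φ X b.src‖ ≤
      σ * ((P.d + 2) * P.L : ℕ) * (B₀ * ((1 + 2 * ((P.d + 2) * P.L : ℕ)) * t)) *
        ((((P.L : ℝ) ^ levOf (fun i => {z : Site P 0 | D.InOm i z}) D.k b.src * η)⁻¹) +
          (((P.L : ℝ) ^ levOf (fun i => {z : Site P 0 | D.InOm i z}) D.k b.tgt * η)⁻¹)) := by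
  classical
  set C : ℝ := (((P.d + 2) * P.L : ℕ) : ℝ) with hC
  set t₁ : ℝ := B₀ * ((1 + 2 * ((P.d + 2) * P.L : ℕ)) * t) with ht₁
  have ht₁0 : 0 ≤ t₁ := by positivity
  set p₁ : SiteIdx D := ⟨⟨⟨levOf (fun i => {z : Site P 0 | D.InOm i z}) D.k b.src, pin_mem D b.src⟩,
      iterBlockOf (levOf (fun i => {z : Site P 0 | D.InOm i z}) D.k b.src) b.src⟩, FlatCubeLevels.lamSite_levOf_inOm D b.src⟩ with hp₁
  set p₂ : SiteIdx D := ⟨⟨⟨levOf (fun i => {z : Site P 0 | D.InOm i z}) D.k b.tgt, pin_mem D b.tgt⟩,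
      iterBlockOf (levOf (fun i => {z : Site P 0 | D.InOm i z}) D.k b.tgt) b.tgt⟩, FlatCubeLevels.lamSite_levOf_inOm D b.tgt⟩ with hp₂
  set f : SiteIdx D → ℝ := fun s => |τ s b.tgt - τ s b.src| * ‖Λ (s.1.1 : ℕ) (Y X) s.1.2‖ with hf
  have hf0 : ∀ s, 0 ≤ f s := fun s => by positivity
  have hfzero : ∀ s, s ≠ p₁ → s ≠ p₂ → f s = 0 := by
    intro s h1 h2
    simp only [hf]
    rw [tau_eq_zero_of_ne D τ hτ0 b.tgt s h2, tau_eq_zero_of_ne D τ hτ0 b.src s h1, sub_zero, abs_zero, zero_mul]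
  have hfle : ∀ s, f s ≤ (if s = p₁ then f p₁ else 0) + (if s = p₂ then f p₂ else 0) := by
    intro s
    by_cases h1 : s = p₁
    · subst h1; simp only [if_true]; split_ifs <;> linarith [hf0 p₂]
    · by_cases h2 : s = p₂
      · subst h2; simp only [if_true, if_neg h1]; linarith
      · rw [hfzero s h1 h2, if_neg h1, if_neg h2, add_zero]
  have hpin : ∀ (x : Site P 0), f ⟨⟨⟨levOf (fun i => {z : Site P 0 | D.InOm i z}) D.k x, pin_mem D x⟩,
      iterBlockOf (levOf (fun i => {z : Site P 0 | D.InOm i z}) D.k x) x⟩, FlatCubeLevels.lamSite_levOf_inOm D x⟩ ≤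
      σ * C * t₁ * (((P.L : ℝ) ^ levOf (fun i => {z : Site P 0 | D.InOm i z}) D.k x * η)⁻¹) := by
    intro x
    set j := levOf (fun i => {z : Site P 0 | D.InOm i z}) D.k x with hj
    have hLj : 0 < (P.L : ℝ) ^ j := by have := P.L_pos; positivity
    have hwpos : 0 < (P.L : ℝ) ^ j * η := by positivity
    have hΛ := norm_Lam_pin_le D η Λ hΛ0 hΛs Xf hXf κ hκ0 hκs Xt hXt H₀ Y hY w₁ hw₁ hsup hη hB₀ X ht hX
      ⟨⟨⟨j, pin_mem D x⟩, iterBlockOf j x⟩, FlatCubeLevels.lamSite_levOf_inOm D x⟩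
    have hτ := hτlipσ ⟨⟨⟨j, pin_mem D x⟩, iterBlockOf j x⟩, FlatCubeLevels.lamSite_levOf_inOm D x⟩ b
    simp only at hΛ hτ
    simp only [hf]
    calc |τ _ b.tgt - τ _ b.src| * ‖Λ j (Y X) (iterBlockOf j x)‖
        ≤ (σ / (P.L : ℝ) ^ j) * (C * (P.L : ℝ) ^ j * (t₁ / ((P.L : ℝ) ^ j * η))) :=
          mul_le_mul hτ hΛ (norm_nonneg _) (by positivity)
      _ = σ * C * t₁ * (((P.L : ℝ) ^ j * η)⁻¹) := by field_simp
  have hdiff : φ X b.tgt - φ X b.src = ∑ s : SiteIdx D, (τ s b.tgt - τ s b.src) • Λ (s.1.1 : ℕ) (Y X) s.1.2 := by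
    rw [hφ, hφ, ← Finset.sum_sub_distrib]
    refine Finset.sum_congr rfl fun s _ => ?_
    rw [sub_smul]
  rw [hdiff]
  calc ‖∑ s : SiteIdx D, (τ s b.tgt - τ s b.src) • Λ (s.1.1 : ℕ) (Y X) s.1.2‖ ≤ ∑ s, f s := by
        refine (norm_sum_le _ _).trans (Finset.sum_le_sum fun s _ => ?_)
        rw [norm_smul, Real.norm_eq_abs]
    _ ≤ ∑ s, ((if s = p₁ then f p₁ else 0) + (if s = p₂ then f p₂ else 0)) := Finset.sum_le_sum fun s _ => hfle s
    _ = f p₁ + f p₂ := by rw [Finset.sum_add_distrib, Finset.sum_ite_eq' Finset.univ p₁, Finset.sum_ite_eq' Finset.univ p₂]; simp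
    _ ≤ σ * C * t₁ * (((P.L : ℝ) ^ levOf (fun i => {z : Site P 0 | D.InOm i z}) D.k b.src * η)⁻¹) +
          σ * C * t₁ * (((P.L : ℝ) ^ levOf (fun i => {z : Site P 0 | D.InOm i z}) D.k b.tgt * η)⁻¹) := add_le_add (hpin b.src) (hpin b.tgt)
    _ = _ := by ring

include hΛ0 hΛs hXf hκ0 hκs hXt hY hτ0 hφ hw₁ hsup hτlipσ hσ in
/-- **THE SUP ROW OF `H X = Y + dφ` FOR SLOPE-`σ` TENTS**: `w₁(b)·‖HX(b)‖ ≤ B₀(1 + 2C)(1 + σC(1 + L))·t`, `C = (d+2)L` (territory collar `R·M ≥ 1`).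
[cite: Balaban1985Variational, (46) p.285] -/
theorem letter_of_slope {R M : ℕ} (hAdm : Adm22 D R M) (hRM : 1 ≤ R * M) (hη : 0 < η) (hB₀ : 0 ≤ B₀)
    (Hf : (BondIdx D → Matrix n n ℂ) → PBond P 0 → Matrix n n ℂ) (hHf : ∀ X b, Hf X b = Y X b + (φ X b.tgt - φ X b.src))
    (X : BondIdx D → Matrix n n ℂ) {t : ℝ} (ht : 0 ≤ t) (hX : ∀ i, ‖X i‖ ≤ t) (b : PBond P 0) :
    w₁ b * ‖Hf X b‖ ≤ B₀ * ((1 + 2 * ((P.d + 2) * P.L : ℕ)) * (1 + σ * ((P.d + 2) * P.L : ℕ) * (1 + P.L))) * t := by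
  set C : ℝ := (((P.d + 2) * P.L : ℕ) : ℝ) with hC
  set t₁ : ℝ := B₀ * ((1 + 2 * ((P.d + 2) * P.L : ℕ)) * t) with ht₁
  have ht₁0 : 0 ≤ t₁ := by positivity
  set j₁ := levOf (fun i => {z : Site P 0 | D.InOm i z}) D.k b.src with hj₁
  set j₂ := levOf (fun i => {z : Site P 0 | D.InOm i z}) D.k b.tgt with hj₂
  have hL1 : (1 : ℝ) ≤ P.L := by exact_mod_cast P.L_pos
  have hw : w₁ b = (P.L : ℝ) ^ j₁ * η := hw₁ b
  have hw0 : 0 ≤ w₁ b := by rw [hw]; positivity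
  have hY' := letter_Y D η Xf hXf κ hκ0 hκs Xt hXt H₀ Y hY w₁ hw₁ hsup hη X ht hX b
  have hφ' := norm_dphi_le_of_slope D η Λ hΛ0 hΛs Xf hXf κ hκ0 hκs Xt hXt H₀ Y hY τ hτ0 φ hφ w₁ hw₁ hsup hσ hτlipσ hη hB₀ X ht hX b
  have hlev := (levOf_endpoints_le_succ D hAdm hRM b).1
  have hratio : (P.L : ℝ) ^ j₁ * (((P.L : ℝ) ^ j₂ * η)⁻¹ * η) ≤ P.L := by
    rw [mul_inv, mul_assoc, inv_mul_cancel₀ hη.ne', mul_one, ← div_eq_mul_inv, div_le_iff₀ (by positivity), ← pow_succ']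
    exact pow_le_pow_right₀ hL1 hlev
  have hself : (P.L : ℝ) ^ j₁ * η * (((P.L : ℝ) ^ j₁ * η)⁻¹) = 1 := mul_inv_cancel₀ (by positivity)
  calc w₁ b * ‖Hf X b‖ ≤ w₁ b * (‖Y X b‖ + ‖φ X b.tgt - φ X b.src‖) := by
        rw [hHf]; exact mul_le_mul_of_nonneg_left (norm_add_le _ _) hw0
    _ ≤ t₁ + w₁ b * (σ * C * t₁ * ((((P.L : ℝ) ^ j₁ * η)⁻¹) + (((P.L : ℝ) ^ j₂ * η)⁻¹))) := by
        rw [mul_add]; exact add_le_add hY' (mul_le_mul_of_nonneg_left hφ' hw0)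
    _ = t₁ + σ * C * t₁ * ((P.L : ℝ) ^ j₁ * η * (((P.L : ℝ) ^ j₁ * η)⁻¹) + (P.L : ℝ) ^ j₁ * (((P.L : ℝ) ^ j₂ * η)⁻¹ * η)) := by
        rw [hw]; ring
    _ ≤ t₁ + σ * C * t₁ * (1 + P.L) := by
        rw [hself]
        have : 0 ≤ σ * C * t₁ := by positivity
        nlinarith [hratio]
    _ = _ := by rw [ht₁, hC]; ring

include hΛ0 hΛs hXf hκ0 hκs hXt hY hτ0 hφ hw₁ hw₂ hsup hτd2 in
/-- **THE MIXED SECOND DIFFERENCE OF THE GAUGE PART**: for `b = ⟨x, μ⟩` and a direction `ν`,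
`w₂(b)·η⁻¹·‖(φ(x+e_ν+e_μ) − φ(x+e_ν)) − (φ(x+e_μ) − φ(x))‖ ≤ 256·C·L⁴·B₀(1+2C)·t` — only the tents pinned at the (at most four) territories of
`x, x+e_ν, x+e_μ, x+e_ν+e_μ` move, each with second differences `≤ 64/L^{2j_s}` against `‖Λ_s‖ ≤ C·L^{j_s}·t₁/(L^{j_s}η)`, and the collar gives `j(x) ≤ j_s + 2`.
[cite: Balaban1985Variational, (46) p.285] -/
theorem norm_d2phi_le {R M : ℕ} (hAdm : Adm22 D R M) (hRM : 1 ≤ R * M) (hη : 0 < η) (hB₀ : 0 ≤ B₀) (X : BondIdx D → Matrix n n ℂ) {t : ℝ}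
    (ht : 0 ≤ t) (hX : ∀ i, ‖X i‖ ≤ t) (b : PBond P 0) (ν : Fin P.d) :
    w₂ b * η⁻¹ * ‖(φ X ((b.src.shift ν).shift b.dir) - φ X (b.src.shift ν)) - (φ X (b.src.shift b.dir) - φ X b.src)‖ ≤
      256 * ((P.d + 2) * P.L : ℕ) * (P.L : ℝ) ^ 4 * (B₀ * ((1 + 2 * ((P.d + 2) * P.L : ℕ)) * t)) := by
  classical
  set C : ℝ := (((P.d + 2) * P.L : ℕ) : ℝ) with hC
  set t₁ : ℝ := B₀ * ((1 + 2 * ((P.d + 2) * P.L : ℕ)) * t) with ht₁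
  have ht₁0 : 0 ≤ t₁ := by positivity
  have hL1 : (1 : ℝ) ≤ P.L := by exact_mod_cast P.L_pos
  have hL0 : (0 : ℝ) < P.L := by positivity
  set x := b.src with hx
  set μ := b.dir with hμ
  -- the pin of a fine site and the four sites
  let pin : Site P 0 → SiteIdx D := fun z => ⟨⟨⟨levOf (fun i => {z : Site P 0 | D.InOm i z}) D.k z, pin_mem D z⟩,
      iterBlockOf (levOf (fun i => {z : Site P 0 | D.InOm i z}) D.k z) z⟩, FlatCubeLevels.lamSite_levOf_inOm D z⟩
  have hpin_def : ∀ z, pin z = ⟨⟨⟨levOf (fun i => {z : Site P 0 | D.InOm i z}) D.k z, pin_mem D z⟩,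
      iterBlockOf (levOf (fun i => {z : Site P 0 | D.InOm i z}) D.k z) z⟩, FlatCubeLevels.lamSite_levOf_inOm D z⟩ := fun _ => rfl
  set x₁ := x.shift ν with hx₁
  set x₂ := x.shift μ with hx₂
  set x₃ := (x.shift ν).shift μ with hx₃
  -- `f s = |Δ²τ_s|·‖Λ_s‖`
  set f : SiteIdx D → ℝ := fun s => |τ s x₃ - τ s x₁ - τ s x₂ + τ s x| * ‖Λ (s.1.1 : ℕ) (Y X) s.1.2‖ with hf
  have hf0 : ∀ s, 0 ≤ f s := fun s => by positivity
  have hfzero : ∀ s, s ≠ pin x → s ≠ pin x₁ → s ≠ pin x₂ → s ≠ pin x₃ → f s = 0 := by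
    intro s h0 h1 h2 h3
    simp only [hf]
    rw [tau_eq_zero_of_ne D τ hτ0 x₃ s h3, tau_eq_zero_of_ne D τ hτ0 x₁ s h1, tau_eq_zero_of_ne D τ hτ0 x₂ s h2,
      tau_eq_zero_of_ne D τ hτ0 x s h0]
    simp
  -- the weight against one pin term
  have hb₁ : levOf (fun i => {z : Site P 0 | D.InOm i z}) D.k x ≤ levOf (fun i => {z : Site P 0 | D.InOm i z}) D.k x₁ + 1 :=
    (levOf_endpoints_le_succ D hAdm hRM ⟨x, ν⟩).1
  have hb₂ : levOf (fun i => {z : Site P 0 | D.InOm i z}) D.k x ≤ levOf (fun i => {z : Site P 0 | D.InOm i z}) D.k x₂ + 1 :=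
    (levOf_endpoints_le_succ D hAdm hRM ⟨x, μ⟩).1
  have hb₃ : levOf (fun i => {z : Site P 0 | D.InOm i z}) D.k x₁ ≤ levOf (fun i => {z : Site P 0 | D.InOm i z}) D.k x₃ + 1 :=
    (levOf_endpoints_le_succ D hAdm hRM ⟨x.shift ν, μ⟩).1
  have hlev₁ : levOf (fun i => {z : Site P 0 | D.InOm i z}) D.k x ≤ levOf (fun i => {z : Site P 0 | D.InOm i z}) D.k x₁ + 2 := by omega
  have hlev₂ : levOf (fun i => {z : Site P 0 | D.InOm i z}) D.k x ≤ levOf (fun i => {z : Site P 0 | D.InOm i z}) D.k x₂ + 2 := by omega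
  have hlev₃ : levOf (fun i => {z : Site P 0 | D.InOm i z}) D.k x ≤ levOf (fun i => {z : Site P 0 | D.InOm i z}) D.k x₃ + 2 := by omega
  have hlev₀ : levOf (fun i => {z : Site P 0 | D.InOm i z}) D.k x ≤ levOf (fun i => {z : Site P 0 | D.InOm i z}) D.k x + 2 := by omega
  have hterm : ∀ z : Site P 0, levOf (fun i => {z : Site P 0 | D.InOm i z}) D.k x ≤ levOf (fun i => {z : Site P 0 | D.InOm i z}) D.k z + 2 →
      w₂ b * η⁻¹ * f (pin z) ≤ 64 * C * (P.L : ℝ) ^ 4 * t₁ := by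
    intro z hz
    set j := levOf (fun i => {z : Site P 0 | D.InOm i z}) D.k x with hj
    set j' := levOf (fun i => {z : Site P 0 | D.InOm i z}) D.k z with hj'
    have hLj : 0 < (P.L : ℝ) ^ j' := by positivity
    have hΛ := norm_Lam_pin_le D η Λ hΛ0 hΛs Xf hXf κ hκ0 hκs Xt hXt H₀ Y hY w₁ hw₁ hsup hη hB₀ X ht hX (pin z)
    have hτ := hτd2 (pin z) x μ ν
    simp only [hpin_def] at hΛ hτ
    have hfz : f (pin z) ≤ (64 / ((P.L : ℝ) ^ j') ^ 2) * (C * (P.L : ℝ) ^ j' * (t₁ / ((P.L : ℝ) ^ j' * η))) := by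
      simp only [hf, hpin_def]
      exact mul_le_mul hτ hΛ (norm_nonneg _) (by positivity)
    have hw : w₂ b * η⁻¹ = ((P.L : ℝ) ^ j) ^ 2 * η := by
      rw [hw₂, ← hx, ← hj]; field_simp
    have hpow : ((P.L : ℝ) ^ j) ^ 2 ≤ (P.L : ℝ) ^ 4 * ((P.L : ℝ) ^ j') ^ 2 := by
      have h1 : (P.L : ℝ) ^ j ≤ (P.L : ℝ) ^ (j' + 2) := pow_le_pow_right₀ hL1 hz
      calc ((P.L : ℝ) ^ j) ^ 2 ≤ ((P.L : ℝ) ^ (j' + 2)) ^ 2 := pow_le_pow_left₀ (by positivity) h1 2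
        _ = (P.L : ℝ) ^ 4 * ((P.L : ℝ) ^ j') ^ 2 := by ring
    have hw0 : 0 ≤ w₂ b * η⁻¹ := by rw [hw]; positivity
    calc w₂ b * η⁻¹ * f (pin z) ≤ w₂ b * η⁻¹ * ((64 / ((P.L : ℝ) ^ j') ^ 2) * (C * (P.L : ℝ) ^ j' * (t₁ / ((P.L : ℝ) ^ j' * η)))) :=
          mul_le_mul_of_nonneg_left hfz hw0
      _ = 64 * C * t₁ * (((P.L : ℝ) ^ j) ^ 2 / ((P.L : ℝ) ^ j') ^ 2) := by rw [hw]; field_simp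
      _ ≤ 64 * C * t₁ * (P.L : ℝ) ^ 4 := by
          refine mul_le_mul_of_nonneg_left ?_ (by positivity)
          rw [div_le_iff₀ (by positivity)]; exact hpow
      _ = 64 * C * (P.L : ℝ) ^ 4 * t₁ := by ring
  -- the decomposition of the mixed difference
  have hdiff : (φ X x₃ - φ X x₁) - (φ X x₂ - φ X x) = ∑ s : SiteIdx D, (τ s x₃ - τ s x₁ - τ s x₂ + τ s x) • Λ (s.1.1 : ℕ) (Y X) s.1.2 := by
    rw [hφ, hφ, hφ, hφ, ← Finset.sum_sub_distrib, ← Finset.sum_sub_distrib, ← Finset.sum_sub_distrib]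
    refine Finset.sum_congr rfl fun s _ => ?_
    rw [← sub_smul, ← sub_smul, ← sub_smul]
    congr 1; ring
  -- bound the sum by the four pin terms
  have hfle : ∀ s, f s ≤ (if s = pin x then f s else 0) + (if s = pin x₁ then f s else 0) + (if s = pin x₂ then f s else 0) +
      (if s = pin x₃ then f s else 0) := by
    intro s
    have i0 : 0 ≤ (if s = pin x then f s else 0) := by split_ifs <;> [exact hf0 s; exact le_rfl]
    have i1 : 0 ≤ (if s = pin x₁ then f s else 0) := by split_ifs <;> [exact hf0 s; exact le_rfl]
    have i2 : 0 ≤ (if s = pin x₂ then f s else 0) := by split_ifs <;> [exact hf0 s; exact le_rfl]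
    have i3 : 0 ≤ (if s = pin x₃ then f s else 0) := by split_ifs <;> [exact hf0 s; exact le_rfl]
    by_cases h0 : s = pin x
    · rw [if_pos h0]; linarith
    · by_cases h1 : s = pin x₁
      · rw [if_pos h1]; linarith
      · by_cases h2 : s = pin x₂
        · rw [if_pos h2]; linarith
        · by_cases h3 : s = pin x₃
          · rw [if_pos h3]; linarith
          · rw [if_neg h0, if_neg h1, if_neg h2, if_neg h3, hfzero s h0 h1 h2 h3]; norm_num
  have hw0 : 0 ≤ w₂ b * η⁻¹ := by rw [hw₂]; positivity
  have hsum_ite : ∀ z : Site P 0, ∑ s : SiteIdx D, (if s = pin z then f s else 0) = f (pin z) := fun z => by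
    rw [Finset.sum_ite_eq' Finset.univ (pin z)]; simp
  rw [hdiff]
  calc w₂ b * η⁻¹ * ‖∑ s : SiteIdx D, (τ s x₃ - τ s x₁ - τ s x₂ + τ s x) • Λ (s.1.1 : ℕ) (Y X) s.1.2‖
      ≤ w₂ b * η⁻¹ * ∑ s, f s := by
        refine mul_le_mul_of_nonneg_left ((norm_sum_le _ _).trans (Finset.sum_le_sum fun s _ => ?_)) hw0
        rw [norm_smul, Real.norm_eq_abs]
    _ ≤ w₂ b * η⁻¹ * ∑ s, ((if s = pin x then f s else 0) + (if s = pin x₁ then f s else 0) + (if s = pin x₂ then f s else 0) +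
          (if s = pin x₃ then f s else 0)) := mul_le_mul_of_nonneg_left (Finset.sum_le_sum fun s _ => hfle s) hw0
    _ = w₂ b * η⁻¹ * f (pin x) + w₂ b * η⁻¹ * f (pin x₁) + w₂ b * η⁻¹ * f (pin x₂) + w₂ b * η⁻¹ * f (pin x₃) := by
        rw [Finset.sum_add_distrib, Finset.sum_add_distrib, Finset.sum_add_distrib, hsum_ite, hsum_ite, hsum_ite, hsum_ite]; ring
    _ ≤ 64 * C * (P.L : ℝ) ^ 4 * t₁ + 64 * C * (P.L : ℝ) ^ 4 * t₁ + 64 * C * (P.L : ℝ) ^ 4 * t₁ + 64 * C * (P.L : ℝ) ^ 4 * t₁ :=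
        add_le_add (add_le_add (add_le_add (hterm x hlev₀) (hterm x₁ hlev₁)) (hterm x₂ hlev₂)) (hterm x₃ hlev₃)
    _ = 256 * C * (P.L : ℝ) ^ 4 * t₁ := by ring

include hΛ0 hΛs hXf hκ0 hκs hXt hY hτ0 hφ hw₁ hw₂ hsup hgrad hτd2 in
/-- **THE (46) GRADIENT ROW OF `H X = Y + dφ` ON C^{1,1} TENTS**: under (2.2)-admissibility with `R·M ≥ 1`,
`w₂(b)·η⁻¹·‖HX⟨b₋+e_ν, dir b⟩ − HX b‖ ≤ B₀(1 + 2C)(1 + 256·C·L⁴)·t` for `‖X‖_∞ ≤ t`, `C = (d+2)L` — k-UNIFORM; the second letter of F4's currency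
(`w 2 b·L^{K−n}·‖·‖` at the carrier). [cite: Balaban1985Variational, (46) p.285, (152) p.301] -/
theorem letter_grad {R M : ℕ} (hAdm : Adm22 D R M) (hRM : 1 ≤ R * M) (hη : 0 < η) (hB₀ : 0 ≤ B₀)
    (Hf : (BondIdx D → Matrix n n ℂ) → PBond P 0 → Matrix n n ℂ) (hHf : ∀ X b, Hf X b = Y X b + (φ X b.tgt - φ X b.src))
    (X : BondIdx D → Matrix n n ℂ) {t : ℝ} (ht : 0 ≤ t) (hX : ∀ i, ‖X i‖ ≤ t) (b : PBond P 0) (ν : Fin P.d) :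
    w₂ b * η⁻¹ * ‖Hf X ⟨b.src.shift ν, b.dir⟩ - Hf X b‖ ≤
      B₀ * ((1 + 2 * ((P.d + 2) * P.L : ℕ)) * (1 + 256 * ((P.d + 2) * P.L : ℕ) * (P.L : ℝ) ^ 4)) * t := by
  have hY' := letter_Y_grad D η Xf hXf κ hκ0 hκs Xt hXt H₀ Y hY w₂ hw₂ hgrad hη X ht hX b ν
  have hφ' := norm_d2phi_le D η Λ hΛ0 hΛs Xf hXf κ hκ0 hκs Xt hXt H₀ Y hY τ hτ0 φ hφ w₁ hw₁ w₂ hw₂ hsup hτd2 hAdm hRM hη hB₀ X ht hX b ν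
  have hw0 : 0 ≤ w₂ b * η⁻¹ := by rw [hw₂]; positivity
  have e : Hf X ⟨b.src.shift ν, b.dir⟩ - Hf X b =
      (Y X ⟨b.src.shift ν, b.dir⟩ - Y X b) + ((φ X ((b.src.shift ν).shift b.dir) - φ X (b.src.shift ν)) - (φ X (b.src.shift b.dir) - φ X b.src)) := by
    rw [hHf, hHf]
    show Y X ⟨b.src.shift ν, b.dir⟩ + (φ X ((b.src.shift ν).shift b.dir) - φ X (b.src.shift ν)) - (Y X b + (φ X (b.src.shift b.dir) - φ X b.src)) = _
    abel
  rw [e]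
  calc w₂ b * η⁻¹ * ‖(Y X ⟨b.src.shift ν, b.dir⟩ - Y X b) +
        ((φ X ((b.src.shift ν).shift b.dir) - φ X (b.src.shift ν)) - (φ X (b.src.shift b.dir) - φ X b.src))‖
      ≤ w₂ b * η⁻¹ * (‖Y X ⟨b.src.shift ν, b.dir⟩ - Y X b‖ +
          ‖(φ X ((b.src.shift ν).shift b.dir) - φ X (b.src.shift ν)) - (φ X (b.src.shift b.dir) - φ X b.src)‖) :=
        mul_le_mul_of_nonneg_left (norm_add_le _ _) hw0
    _ ≤ B₀ * ((1 + 2 * ((P.d + 2) * P.L : ℕ)) * t) + 256 * ((P.d + 2) * P.L : ℕ) * (P.L : ℝ) ^ 4 * (B₀ * ((1 + 2 * ((P.d + 2) * P.L : ℕ)) * t)) := by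
        rw [mul_add]; exact add_le_add hY' hφ'
    _ = _ := by ring

end Letter

end Construction

end Summit.QuantumFields.YangMills.Theorems.ChartHInv

end
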